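import Literature.NumberTheory.GaloisRepresentations.LocalClassFieldAxiom
import Mathlib.GroupTheory.Index
import HarnessLib

/-!
# Route `ByReductionTypeAtTwo`, item `OrdKatoHalfAtTwo` (stmt-BirchSwinnertonDyer-19271), TOWER road, the
# GOOD-ORDINARY local constant at `v ∣ 2`: KERNEL BRICK G6b — the index `[B_ρ : π B_ρ] = (𝒪_K : π𝒪_K)^{[L:K]}` of
# balls in a finite extension `L` of a complete non-archimedean field `K` (coordinate lattices, no ring of integers)

HONEST FRAMING (cell `bsd-2adic`, run/shared/lean/pub/bsd-2adic/, seat `bsd-2adic-tower-1` GEN 11, HUMAN RULINGS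
D-0036 / D-0054 / D-0074): TOOL theorems only (no definition, no named fact, no `sorry`); closes nothing by itself;
nothing booked; BSD is not proved by any of this. Part of the KERNELISATION of the consumed projection `#𝒦_{v,n}[2^∞][2] ≤ 4`
of the PRINT binder `hS34 = Greenberg1999.lemma34_localTowerKerPrimary_cyclicExtension_rat`: the arithmetic input
«`(𝒪[L_n] : p) = p^{[L_n:ℚ_p]}`» of the WALL (M4) of the scope memo HOME/tower/SCOPE-hS34-layer-kernel-at-2-GEN7.md §3, in
the form the generic engine `FormalGroupDivision.relIndex_map_nsmul_kernelLevel_eq` consumes — an index of BALLS of `L` —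
proved WITHOUT the ring of integers of `L`, by the coordinate-lattice technique of the tree's class field axiom
(`LocalClassFieldAxiom.lean`, `CyclicNormIndex.latt`): for a basis `b` of `L/K` the lattices `M_s = {x : ∀ i, ‖x_i‖ ≤ ‖π‖^s}`
sandwich the balls (`M_{m+l} ⊆ B_{‖π‖^m} ⊆ M_{m-k}`, continuity of coordinates and the ultrametric inequality),
`[M_s : M_{s+1}] = [𝒪_K : π𝒪_K]^{[L:K]}` (coordinates), and `[B : πB] = [M : πM]` for any lattice `M` of finite index in
`B` (index calculus with the injective endomorphism `x ↦ πx`).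

* `relIndex_map_eq_of_finiteRelIndex` — `[B : φB] = [M : φM]` for an injective endomorphism `φ` with `φM ≤ M ≤ B`,
  `φB ≤ B`, `[B : M] < ∞`;
* `relIndex_pi_const` — `[K^ι : H^ι] = [K : H]^{#ι}`;
* `latt_eq_comap_pi`, `relIndex_latt_succ` — `[M_s : M_{s+1}] = [B^K_1 : B^K_{‖π‖}]^{[L:K]}`, `relIndex_latt_ne_zero`;
* `exists_latt_le_ball`, `exists_ball_le_latt` — the sandwich;
* **`exists_relIndex_ball_eq_pow`** — for `0 < ‖π‖ < 1` there is `m ≥ 2` with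
  `[B_{‖π‖^m}(L) : B_{‖π‖^{m+1}}(L)] = [B_1(K) : B_{‖π‖}(K)]^{[L:K]}` and `[B_1(L) : B_{‖π‖^m}(L)] < ∞`
  (balls for the spectral norm of `L/K`, as `Valuation.leAddSubgroup` of `NormedField.valuation`).

References: J. Neukirch, *ANT* (1999), Ch. II (4.8), Ch. V §1 (1.1) (proof: the lattice `M = ∑ 𝒪_K α^σ`); J. Silverman,
*AEC* (2009), VII.6.3 («`E(K)` contains a subgroup of finite index isomorphic to `R⁺`», `(R : nR)`); scope memo §3 (M4).
-/

set_option autoImplicit false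
-- the Theorems namespace of this sub repeats the summit name by design (D-0017 nested layout: Summit.<S>.<Sub>)
set_option linter.dupNamespace false

noncomputable section

open scoped Classical NNReal

namespace Summit.BirchSwinnertonDyer.BirchSwinnertonDyer.Theorems.GoodOrdTower

open Literature.NumberTheory.GaloisRepresentations Literature.NumberTheory.GaloisRepresentations.CyclicNormIndex

/-! ### Index calculus -/

section IndexCalculus

variable {G : Type*} [AddCommGroup G]

/-- **`[B : φB] = [M : φM]`** for an injective endomorphism `φ` of an additive group and subgroups `φM ≤ M ≤ B`,
`φB ≤ B` with `[B : M]` finite: both sides times `[B : M] = [φB : φM]` equal `[B : φM]`. [folklore] -/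
theorem relIndex_map_eq_of_finiteRelIndex (φ : G →+ G) (hφ : Function.Injective φ) {M B : AddSubgroup G}
    (hMB : M ≤ B) (hφM : M.map φ ≤ M) (hφB : B.map φ ≤ B) (hfin : M.relIndex B ≠ 0) :
    (B.map φ).relIndex B = (M.map φ).relIndex M := by
  -- `[B : φM] = [φB : φM]·[B : φB]` hmm: chains `φM ≤ φB ≤ B` and `φM ≤ M ≤ B`
  have hφMφB : M.map φ ≤ B.map φ := AddSubgroup.map_mono hMB
  have h1 : (M.map φ).relIndex (B.map φ) * (B.map φ).relIndex B = (M.map φ).relIndex B :=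
    AddSubgroup.relIndex_mul_relIndex _ _ _ hφMφB hφB
  have h2 : (M.map φ).relIndex M * M.relIndex B = (M.map φ).relIndex B :=
    AddSubgroup.relIndex_mul_relIndex _ _ _ hφM hMB
  have h3 : (M.map φ).relIndex (B.map φ) = M.relIndex B := AddSubgroup.relIndex_map_map_of_injective M B hφ
  rw [h3] at h1
  have h4 : M.relIndex B * (B.map φ).relIndex B = (M.map φ).relIndex M * M.relIndex B := by rw [h1, h2]
  rw [mul_comm] at h4
  exact mul_right_cancel₀ hfin h4

/-- **`[K^ι : H^ι] = [K : H]^{#ι}`** for subgroups `H, K` of an additive group and a finite index type `ι`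
(the subgroup `K^ι` of `A^ι` is isomorphic to the power `(↥K)^ι`, under which `H^ι` becomes `(H ∩ K)^ι`; then Mathlib's
`AddSubgroup.index_pi`). [folklore] -/
theorem relIndex_pi_const {ι : Type*} [Fintype ι] {A : Type*} [AddCommGroup A] (H K : AddSubgroup A) :
    (AddSubgroup.pi Set.univ fun _ : ι ↦ H).relIndex (AddSubgroup.pi Set.univ fun _ : ι ↦ K) =
      H.relIndex K ^ Fintype.card ι := by
  -- the isomorphism `↥(K^ι) ≃+ (↥K)^ι`
  let e : AddSubgroup.pi Set.univ (fun _ : ι ↦ K) →+ (ι → K) :=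
    { toFun := fun f ↦ fun i ↦ ⟨f.1 i, f.2 i (Set.mem_univ i)⟩
      map_zero' := rfl
      map_add' := fun _ _ ↦ rfl }
  have he : Function.Surjective e := fun g ↦ ⟨⟨fun i ↦ (g i : A), fun i _ ↦ (g i).2⟩, rfl⟩
  have hcomap : (AddSubgroup.pi Set.univ fun _ : ι ↦ H).addSubgroupOf (AddSubgroup.pi Set.univ fun _ : ι ↦ K) =
      (AddSubgroup.pi Set.univ fun _ : ι ↦ H.addSubgroupOf K).comap e := by
    ext f
    simp only [AddSubgroup.mem_addSubgroupOf, AddSubgroup.mem_comap, AddSubgroup.mem_pi, Set.mem_univ,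
      true_implies]
    exact Iff.rfl
  rw [AddSubgroup.relIndex, hcomap, AddSubgroup.index_comap_of_surjective _ he,
    AddSubgroup.index_pi (fun _ : ι ↦ H.addSubgroupOf K), Finset.prod_const, Finset.card_univ]
  rfl

/-- Scaling the balls of a valued field: `c^s B_r = B_{|c|^s r}` (`c ≠ 0`). [folklore] -/
theorem map_mulLeft_leAddSubgroup {F : Type*} [Field F] (u : Valuation F ℝ≥0) {c : F} (hc : c ≠ 0)
    (s : ℕ) (r : ℝ≥0) :
    (u.leAddSubgroup r).map (AddMonoidHom.mulLeft (c ^ s)) = u.leAddSubgroup (u c ^ s * r) := by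
  ext y
  simp only [AddSubgroup.mem_map, Valuation.mem_leAddSubgroup_iff, AddMonoidHom.coe_mulLeft]
  constructor
  · rintro ⟨x, hx, rfl⟩
    rw [map_mul, map_pow]
    exact mul_le_mul' le_rfl hx
  · intro hy
    have hcs : c ^ s ≠ 0 := pow_ne_zero s hc
    refine ⟨(c ^ s)⁻¹ * y, ?_, by rw [← mul_assoc, mul_inv_cancel₀ hcs, one_mul]⟩
    rw [map_mul, map_inv₀, map_pow]
    have h0 : 0 < u c ^ s := pow_pos ((Valuation.pos_iff u).mpr hc) s
    rw [inv_mul_le_iff₀ h0]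
    exact hy

end IndexCalculus

/-! ### Coordinate lattices and balls in a finite extension of a complete non-archimedean field -/

section Lattice

variable {K : Type*} [NontriviallyNormedField K] [CompleteSpace K] [IsUltrametricDist K]
variable {L : Type*} [Field L] [Algebra K L] [FiniteDimensional K L]
variable {ι : Type*} [Fintype ι] (b : Module.Basis ι K L) {π : K}

omit [CompleteSpace K] [FiniteDimensional K L] in
/-- The coordinate lattice `M_s` is the preimage of the box `∏ B^K_{‖π‖^s}` under the coordinate map. [folklore] -/
theorem latt_eq_comap_pi (s : ℕ) :
    latt b π s = (AddSubgroup.pi Set.univ fun _ : ι ↦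
      (NormedField.valuation : Valuation K ℝ≥0).leAddSubgroup (‖π‖₊ ^ s)).comap
        b.equivFun.toLinearMap.toAddMonoidHom := by
  ext x
  simp only [mem_latt_iff, AddSubgroup.mem_comap, AddSubgroup.mem_pi, Set.mem_univ, true_implies,
    Valuation.mem_leAddSubgroup_iff, NormedField.valuation_apply, LinearMap.toAddMonoidHom_coe,
    LinearEquiv.coe_coe, Module.Basis.equivFun_apply]
  refine forall_congr' fun i ↦ ?_
  rw [← NNReal.coe_le_coe, coe_nnnorm, NNReal.coe_pow, coe_nnnorm]

omit [CompleteSpace K] in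
/-- Scaling the balls of `K`: `π^s B^K_r = B^K_{‖π‖^s r}` (`π ≠ 0`). [folklore] -/
theorem map_mulLeft_ball (hπ : π ≠ 0) (s : ℕ) (r : ℝ≥0) :
    ((NormedField.valuation : Valuation K ℝ≥0).leAddSubgroup r).map
        (AddMonoidHom.mulLeft (π ^ s)) =
      (NormedField.valuation : Valuation K ℝ≥0).leAddSubgroup (‖π‖₊ ^ s * r) := by
  rw [← NormedField.valuation_apply π]
  exact map_mulLeft_leAddSubgroup _ hπ s r

omit [CompleteSpace K] [FiniteDimensional K L] in
/-- **`[M_s : M_{s+1}] = [B^K_1 : B^K_{‖π‖}]^{#ι}`** (`π ≠ 0`): the coordinate map identifies `M_s` with the box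
`∏ B^K_{‖π‖^s}`, scaling by `π^s` identifies `B^K_1 ⊇ B^K_{‖π‖}` with `B^K_{‖π‖^s} ⊇ B^K_{‖π‖^{s+1}}`, and
`relIndex_pi_const`. [folklore] -/
theorem relIndex_latt_succ (hπ : π ≠ 0) (s : ℕ) :
    (latt b π (s + 1)).relIndex (latt b π s) =
      (((NormedField.valuation : Valuation K ℝ≥0).leAddSubgroup ‖π‖₊).relIndex
        ((NormedField.valuation : Valuation K ℝ≥0).leAddSubgroup 1)) ^ Fintype.card ι := by
  let e : L →+ (ι → K) := b.equivFun.toLinearMap.toAddMonoidHom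
  have he : Function.Surjective e := b.equivFun.surjective
  rw [latt_eq_comap_pi b (s + 1), latt_eq_comap_pi b s, AddSubgroup.relIndex_comap,
    AddSubgroup.map_comap_eq_self_of_surjective he, relIndex_pi_const]
  congr 1
  -- scaling by `π^s`
  have hinj : Function.Injective (AddMonoidHom.mulLeft (π ^ s) : K →+ K) :=
    fun x y h ↦ mul_left_cancel₀ (pow_ne_zero s hπ) h
  have h := AddSubgroup.relIndex_map_map_of_injective (f := AddMonoidHom.mulLeft (π ^ s))
    ((NormedField.valuation : Valuation K ℝ≥0).leAddSubgroup ‖π‖₊)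
    ((NormedField.valuation : Valuation K ℝ≥0).leAddSubgroup 1) hinj
  rw [map_mulLeft_ball hπ, map_mulLeft_ball hπ, mul_one, ← pow_succ] at h
  exact h

omit [CompleteSpace K] [FiniteDimensional K L] in
/-- The steps of the lattice filtration have finite index when `[B^K_1 : B^K_{‖π‖}]` is finite:
`[M_r : M_{r+j}] ≠ 0`. [folklore] -/
theorem relIndex_latt_ne_zero (hπ : π ≠ 0) (hπ1 : ‖π‖ ≤ 1)
    (hq : ((NormedField.valuation : Valuation K ℝ≥0).leAddSubgroup ‖π‖₊).relIndex
      ((NormedField.valuation : Valuation K ℝ≥0).leAddSubgroup 1) ≠ 0) (r j : ℕ) :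
    (latt b π (r + j)).relIndex (latt b π r) ≠ 0 := by
  induction j with
  | zero => rw [add_zero, AddSubgroup.relIndex_self]; exact one_ne_zero
  | succ j ih =>
    have h := AddSubgroup.relIndex_mul_relIndex (latt b π (r + j + 1)) (latt b π (r + j)) (latt b π r)
      (latt_antitone hπ1 (Nat.le_succ _)) (latt_antitone hπ1 (Nat.le_add_right r j))
    rw [← add_assoc, ← h, relIndex_latt_succ b hπ]
    exact mul_ne_zero (pow_ne_zero _ hq) ih

/-- **Coordinates are bounded**: `‖π‖^k ‖x_i‖ ≤ ‖x‖` for some `k` and all `x ∈ L`, `i` (`‖x‖` the spectral norm;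
continuity of the coordinate functionals on the finite-dimensional `L` over the complete `K`). [folklore] -/
theorem exists_pow_mul_norm_repr_le (hπ0 : 0 < ‖π‖) (hπ1 : ‖π‖ < 1) :
    letI := spectralNorm.nontriviallyNormedField K L
    ∃ k : ℕ, ∀ (x : L) (i : ι), ‖π‖ ^ k * ‖b.repr x i‖ ≤ ‖x‖ := by
  letI := spectralNorm.nontriviallyNormedField K L
  letI : NormedSpace K L := spectralNorm.normedSpace K L
  -- operator norms of the coordinate functionals
  have hbd : ∀ i : ι, ∃ C : ℝ, 0 ≤ C ∧ ∀ x : L, ‖b.repr x i‖ ≤ C * ‖x‖ := fun i ↦ by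
    let f : L →L[K] K := LinearMap.toContinuousLinearMap (b.coord i)
    refine ⟨‖f‖, norm_nonneg _, fun x ↦ ?_⟩
    exact f.le_opNorm x
  choose C hC0 hC using hbd
  -- one exponent for all coordinates
  have hk : ∀ i : ι, ∃ k : ℕ, ‖π‖ ^ k * C i ≤ 1 := fun i ↦ by
    rcases (hC0 i).eq_or_lt with h0 | hpos
    · exact ⟨0, by rw [← h0, mul_zero]; exact zero_le_one⟩
    · obtain ⟨k, hk⟩ := exists_pow_lt_of_lt_one (inv_pos.mpr hpos) hπ1
      exact ⟨k, by rw [← le_div_iff₀ hpos, one_div]; exact hk.le⟩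
  choose k hk using hk
  rcases isEmpty_or_nonempty ι with hι | hι
  · exact ⟨0, fun x i ↦ (IsEmpty.false i).elim⟩
  obtain ⟨k₀, hk₀⟩ := Finite.exists_max k
  refine ⟨k k₀, fun x i ↦ ?_⟩
  have hki : ‖π‖ ^ k k₀ ≤ ‖π‖ ^ k i := pow_le_pow_of_le_one hπ0.le hπ1.le (hk₀ i)
  calc ‖π‖ ^ k k₀ * ‖b.repr x i‖ ≤ ‖π‖ ^ k i * (C i * ‖x‖) :=
        mul_le_mul hki (hC i x) (norm_nonneg _) (pow_nonneg (norm_nonneg _) _)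
    _ = (‖π‖ ^ k i * C i) * ‖x‖ := by ring
    _ ≤ 1 * ‖x‖ := by gcongr; exact hk i
    _ = ‖x‖ := one_mul _

/-- **Lattice elements are small**: `x ∈ M_{s+l} ⇒ ‖x‖ ≤ ‖π‖^s` for some `l` and all `s` (the ultrametric bound
`‖∑ x_i b_i‖ ≤ max ‖x_i‖ ‖b_i‖`). [folklore] -/
theorem exists_norm_le_of_mem_latt (hπ0 : 0 < ‖π‖) (hπ1 : ‖π‖ < 1) :
    letI := spectralNorm.nontriviallyNormedField K L
    ∃ l : ℕ, ∀ (s : ℕ) (x : L), x ∈ latt b π (s + l) → ‖x‖ ≤ ‖π‖ ^ s := by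
  letI := spectralNorm.nontriviallyNormedField K L
  letI : NormedSpace K L := spectralNorm.normedSpace K L
  haveI : IsUltrametricDist L := IsUltrametricDist.isUltrametricDist_of_forall_norm_add_le_max_norm
    (fun a c ↦ isNonarchimedean_spectralNorm (K := K) (L := L) a c)
  -- a bound `D` for the basis vectors and `l` with `‖π‖^l D ≤ 1`
  obtain ⟨D, hD0, hD⟩ : ∃ D : ℝ, 0 < D ∧ ∀ i, ‖b i‖ ≤ D := by
    rcases isEmpty_or_nonempty ι with hι | hι
    · exact ⟨1, one_pos, fun i ↦ (IsEmpty.false i).elim⟩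
    · obtain ⟨i₀, hi₀⟩ := Finite.exists_max fun i ↦ ‖b i‖
      exact ⟨max ‖b i₀‖ 1, lt_max_of_lt_right one_pos, fun i ↦ (hi₀ i).trans (le_max_left _ _)⟩
  obtain ⟨l, hl⟩ := exists_pow_lt_of_lt_one (inv_pos.mpr hD0) hπ1
  have hlD : ‖π‖ ^ l * D ≤ 1 := by rw [← le_div_iff₀ hD0, one_div]; exact hl.le
  refine ⟨l, fun s x hx ↦ ?_⟩
  rw [← b.sum_repr x]
  refine IsUltrametricDist.norm_sum_le_of_forall_le_of_nonneg (pow_nonneg (norm_nonneg _) s) fun i _ ↦ ?_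
  rw [norm_smul]
  calc ‖b.repr x i‖ * ‖b i‖ ≤ ‖π‖ ^ (s + l) * D := mul_le_mul (hx i) (hD i) (norm_nonneg _)
        (pow_nonneg (norm_nonneg _) _)
    _ = ‖π‖ ^ s * (‖π‖ ^ l * D) := by ring
    _ ≤ ‖π‖ ^ s * 1 := by gcongr
    _ = ‖π‖ ^ s := mul_one _

omit [CompleteSpace K] [FiniteDimensional K L] [Fintype ι] in
/-- Scaling the lattices: `π M_s = M_{s+1}` (`π ≠ 0`). [folklore] -/
theorem map_mulLeft_latt (hπ : π ≠ 0) (s : ℕ) :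
    (latt b π s).map (AddMonoidHom.mulLeft (algebraMap K L π)) = latt b π (s + 1) := by
  ext y
  simp only [AddSubgroup.mem_map, AddMonoidHom.coe_mulLeft, mem_latt_iff]
  constructor
  · rintro ⟨x, hx, rfl⟩
    intro i
    rw [← Algebra.smul_def, map_smul, Finsupp.smul_apply, smul_eq_mul, norm_mul, pow_succ, mul_comm]
    exact mul_le_mul (hx i) le_rfl (norm_nonneg _) (pow_nonneg (norm_nonneg _) _)
  · intro hy
    refine ⟨π⁻¹ • y, fun i ↦ ?_, by rw [← Algebra.smul_def, smul_smul, mul_inv_cancel₀ hπ, one_smul]⟩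
    rw [map_smul, Finsupp.smul_apply, smul_eq_mul, norm_mul, norm_inv,
      inv_mul_le_iff₀ (norm_pos_iff.mpr hπ), ← pow_succ']
    exact hy i

/-- **`[B_{‖π‖^m}(L) : B_{‖π‖^{m+1}}(L)] = [B_1(K) : B_{‖π‖}(K)]^{[L:K]}` for some `m ≥ 2`, with
`[B_1(L) : B_{‖π‖^m}(L)] < ∞`** — the balls of the valuation `wL` of `L` given by the spectral norm of `L/K`
(`0 < ‖π‖ < 1`, `[B_1(K) : B_{‖π‖}(K)] < ∞`). Proof: sandwich `M_{m+l} ⊆ B_{‖π‖^m} ⊆ M_1` by coordinate lattices of a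
basis (`exists_pow_mul_norm_repr_le`, `exists_norm_le_of_mem_latt`), `[B : πB] = [M : πM]`
(`relIndex_map_eq_of_finiteRelIndex`) and `[M_s : M_{s+1}] = [B_1(K) : B_{‖π‖}(K)]^{[L:K]}` (`relIndex_latt_succ`). This is
the count `(R : πR)` of Silverman VII.6.3 / Milne I Lemma 3.3 for `L`, without the ring of integers `R` of `L`.
[cite: NeukirchANT1999, Ch. V §1 Thm. (1.1) (proof)] [cite: SilvermanAEC2009, Prop. VII.6.3] -/
theorem exists_relIndex_ball_eq_pow {wL : Valuation L ℝ≥0} (hwL : ∀ x : L, (wL x : ℝ) = spectralNorm K L x)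
    (hπ0 : 0 < ‖π‖) (hπ1 : ‖π‖ < 1)
    (hq : ((NormedField.valuation : Valuation K ℝ≥0).leAddSubgroup ‖π‖₊).relIndex
      ((NormedField.valuation : Valuation K ℝ≥0).leAddSubgroup 1) ≠ 0) :
    ∃ m : ℕ, 1 < m ∧
      (wL.leAddSubgroup (‖π‖₊ * ‖π‖₊ ^ m)).relIndex (wL.leAddSubgroup (‖π‖₊ ^ m)) =
        (((NormedField.valuation : Valuation K ℝ≥0).leAddSubgroup ‖π‖₊).relIndex
          ((NormedField.valuation : Valuation K ℝ≥0).leAddSubgroup 1)) ^ Module.finrank K L ∧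
      (wL.leAddSubgroup (‖π‖₊ ^ m)).relIndex (wL.leAddSubgroup 1) ≠ 0 := by
  letI := spectralNorm.nontriviallyNormedField K L
  have hn : ∀ x : L, wL x = ‖x‖₊ := fun x ↦ NNReal.coe_injective (by rw [hwL, coe_nnnorm]; rfl)
  have hπ : π ≠ 0 := norm_pos_iff.mp hπ0
  have hπle : ‖π‖ ≤ 1 := hπ1.le
  have hπL : wL (algebraMap K L π) = ‖π‖₊ := NNReal.coe_injective (by
    rw [hwL, spectralNorm_extends, coe_nnnorm])
  have hπL0 : algebraMap K L π ≠ 0 := (map_ne_zero _).mpr hπ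
  -- the basis and the two exponents
  let b := Module.finBasis K L
  obtain ⟨k, hk⟩ := exists_pow_mul_norm_repr_le b hπ0 hπ1
  obtain ⟨l, hl⟩ := exists_norm_le_of_mem_latt b hπ0 hπ1
  -- membership in balls through norms
  have hball : ∀ (x : L) (t : ℕ), x ∈ wL.leAddSubgroup (‖π‖₊ ^ t) ↔ ‖x‖ ≤ ‖π‖ ^ t := fun x t ↦ by
    rw [Valuation.mem_leAddSubgroup_iff, hn, ← NNReal.coe_le_coe, coe_nnnorm, NNReal.coe_pow, coe_nnnorm]
  -- `B_{‖π‖^{t+k}} ⊆ M_t` and `M_{t+l} ⊆ B_{‖π‖^t}`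
  have hBM : ∀ t : ℕ, wL.leAddSubgroup (‖π‖₊ ^ (t + k)) ≤ latt b π t := by
    intro t x hx i
    rw [hball] at hx
    have h := (hk x i).trans hx
    rw [pow_add, mul_comm] at h
    exact le_of_mul_le_mul_right h (pow_pos hπ0 k)
  have hMB : ∀ t : ℕ, latt b π (t + l) ≤ wL.leAddSubgroup (‖π‖₊ ^ t) := fun t x hx ↦
    (hball x t).mpr (hl t x hx)
  -- scaling in `L`
  have hinjL : ∀ s : ℕ, Function.Injective (AddMonoidHom.mulLeft (algebraMap K L π ^ s) : L →+ L) :=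
    fun s x y h ↦ mul_left_cancel₀ (pow_ne_zero s hπL0) h
  have hscale : ∀ (s : ℕ) (r : ℝ≥0), (wL.leAddSubgroup r).map (AddMonoidHom.mulLeft (algebraMap K L π ^ s)) =
      wL.leAddSubgroup (‖π‖₊ ^ s * r) := fun s r ↦ by
    rw [map_mulLeft_leAddSubgroup wL hπL0 s r, hπL]
  -- the exponent
  refine ⟨k + 2, Nat.one_lt_succ_succ k, ?_, ?_⟩
  · -- `M = M_{k+2+l} ⊆ B = B_{‖π‖^{k+2}} ⊆ M_2`
    have hMB' : latt b π (k + 2 + l) ≤ wL.leAddSubgroup (‖π‖₊ ^ (k + 2)) := hMB (k + 2)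
    have hBM' : wL.leAddSubgroup (‖π‖₊ ^ (k + 2)) ≤ latt b π 2 := by
      have h := hBM 2; rwa [add_comm] at h
    have hfin : (latt b π (k + 2 + l)).relIndex (wL.leAddSubgroup (‖π‖₊ ^ (k + 2))) ≠ 0 := by
      intro h0
      have h1 := AddSubgroup.relIndex_eq_zero_of_le_right hBM' h0
      have h2 := relIndex_latt_ne_zero b hπ hπle hq 2 (k + l)
      rw [show 2 + (k + l) = k + 2 + l by ring] at h2
      exact h2 h1
    have key := relIndex_map_eq_of_finiteRelIndex (AddMonoidHom.mulLeft (algebraMap K L π)) (by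
        have := hinjL 1; rwa [pow_one] at this) hMB'
      (by rw [map_mulLeft_latt b hπ]; exact latt_antitone hπle (Nat.le_succ _))
      (by
        have h := hscale 1 (‖π‖₊ ^ (k + 2))
        rw [pow_one, pow_one] at h
        rw [h]
        have hπle' : ‖π‖₊ ≤ 1 := by rw [← NNReal.coe_le_coe, coe_nnnorm]; exact hπle
        exact Valuation.leAddSubgroup_monotone wL (mul_le_of_le_one_left' hπle'))
      hfin
    have h1 := hscale 1 (‖π‖₊ ^ (k + 2))
    rw [pow_one, pow_one] at h1
    rw [h1, map_mulLeft_latt b hπ, relIndex_latt_succ b hπ, Fintype.card_fin] at key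
    exact key
  · -- finiteness of `[B_1 : B_{‖π‖^{k+2}}]`, after scaling by `π^k`
    intro h0
    have h := AddSubgroup.relIndex_map_map_of_injective (f := AddMonoidHom.mulLeft (algebraMap K L π ^ k))
      (wL.leAddSubgroup (‖π‖₊ ^ (k + 2))) (wL.leAddSubgroup 1) (hinjL k)
    rw [hscale, hscale, mul_one, ← pow_add, h0] at h
    -- `M_{k+(k+2)+l} ≤ B_{‖π‖^{k+(k+2)}}` and `B_{‖π‖^k} ≤ M_0`
    have hle1 : latt b π (k + (k + 2) + l) ≤ wL.leAddSubgroup (‖π‖₊ ^ (k + (k + 2))) := hMB _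
    have hle2 : wL.leAddSubgroup (‖π‖₊ ^ k) ≤ latt b π 0 := by
      have h := hBM 0; rwa [zero_add] at h
    have h3 := relIndex_latt_ne_zero b hπ hπle hq 0 (k + (k + 2) + l)
    rw [zero_add] at h3
    apply h3
    have h4 : (latt b π (k + (k + 2) + l)).relIndex (wL.leAddSubgroup (‖π‖₊ ^ k)) = 0 :=
      AddSubgroup.relIndex_eq_zero_of_le_left hle1 (by rw [← h])
    exact AddSubgroup.relIndex_eq_zero_of_le_right hle2 h4

end Lattice

end Summit.BirchSwinnertonDyer.BirchSwinnertonDyer.Theorems.GoodOrdTower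

end
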